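import Literature.Geometry.Riemannian.ExpMapHopfRinow
import HarnessLib

/-!
# `exp_p` is injective on the injectivity domain, with image `M ∖ Cut(p)`
(Lee 2018, Prop. 10.32 (a), Thm. 10.34 (b),(c))

Layer 5 of the proof programme for `Literature.Geometry.Riemannian.lee_expMap_injectivityDomain`
(Lee 2018, Thm. 10.34). For a smooth Riemannian metric with geodesically complete Levi-Civita
connection on a connected Hausdorff manifold without boundary:

* `false_of_two_minimizers` — **a geodesic does not minimize past a point reached by a second
  minimizing geodesic** (Lee 2018, Prop. 10.32 (a): "`γ_v|[0,b]` … is the unique unit-speed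
  minimizing curve between its endpoints", whose printed proof builds the broken curve
  `σ ∪ γ_v|[b,b']` and invokes "minimizing curves are smooth geodesics"; here the corner is cut
  explicitly with `edist_expMap_smul_lt` of `ExpMapCornerCutting.lean`): if `v ≠ w`,
  `exp_p v = exp_p w`, `γ_w|[0,1]` is minimizing and `γ_v|[0,s]` is minimizing for some `s > 1`,
  contradiction;
* `injOn_riemannianExpMap_injectivityDomain` — **`exp_p` is injective on `ID(p)`**
  (Thm. 10.34 (c): "the absence of cut points implies that `exp_p` is injective on `ID(p)`");
* `image_injectivityDomain_eq_compl_geodesicCutLocus` — **`exp_p(ID(p)) = M ∖ Cut(p)`**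
  (Thm. 10.34 (c)), and `image_closure_injectivityDomain_eq_univ_of_isGeodesicallyComplete` —
  **`exp_p(closure ID(p)) = M`** (Thm. 10.34 (b)), both through the Hopf–Rinow theorem
  `exists_isMinimizingUpTo_of_isGeodesicallyComplete` (`ExpMapHopfRinow.lean`) and the glue of
  `ExponentialMapProofs.lean`;
* `lee_expMap_injectivityDomain_parts` — parts (b) and (c) of Thm. 10.34 except the invertibility
  of the differential (Prop. 10.20 / Thm. 10.26, Jacobi fields — the remaining layer).

No definitions, no named facts (D-0026).

## References

* J. M. Lee, *Introduction to Riemannian Manifolds*, 2nd ed. (2018), Prop. 10.32, Thm. 10.34.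
  [LeeRiemannianManifolds2018]
-/

noncomputable section

open Bundle Set Filter Function Metric Manifold
open scoped Manifold ContDiff Topology ENNReal NNReal

namespace Literature.Geometry.Riemannian

open Literature.Geometry.Lorentzian
open Literature.Geometry.Lorentzian.PseudoRiemannianMetric

variable {E : Type*} [NormedAddCommGroup E] [NormedSpace ℝ E] {H : Type*} [TopologicalSpace H]
  {I : ModelWithCorners ℝ E H} {M : Type*} [TopologicalSpace M] [ChartedSpace H M]
  [IsManifold I ∞ M] {n : ℕ∞ω} [FiniteDimensional ℝ E] [CompleteSpace E] [T2Space M]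
  [BoundarylessManifold I M]
  (g : PseudoRiemannianMetric I n E (TangentSpace I : M → Type _)) [g.HasLeviCivita]
  [CovariantDerivative.ContMDiffCovariantDerivative g.leviCivita 1]

/-! ### Two minimizing geodesics to the same point -/

/-- **A geodesic ceases to minimize at a point reached by a second minimizing geodesic**
(Lee 2018, Prop. 10.32 (a) and its proof, p. 308). Complete smooth Riemannian manifold,
`v ≠ w ∈ T_pM` with `exp_p v = exp_p w`, `γ_w|[0,1]` minimizing, `γ_v|[0,s]` minimizing, `s > 1`:
contradiction. Proof: `|v| = |w| = d(p, q) = r > 0`; the velocities `γ_v'(1) ≠ γ_w'(1)` (else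
`γ_v = γ_w` by uniqueness), so for small `δ` corner cutting at `q` gives
`d(γ_w(1 - δ/r), γ_v(1 + δ/r)) < 2δ`, while `d(p, γ_v(s)) = sr`, `d(p, γ_w(1-δ/r)) ≤ r - δ` and
`d(γ_v(1+δ/r), γ_v(s)) ≤ sr - r - δ` force `≥ 2δ`. [cite: LeeRiemannianManifolds2018, Prop. 10.32 (a)] -/
theorem false_of_two_minimizers (hn : (∞ : ℕ∞ω) ≤ n) (hg : g.IsRiemannian)
    (hc : IsGeodesicallyComplete g.leviCivita) (p : M) {v w : TangentSpace I p} (hvw : v ≠ w)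
    (hq : expMap g.leviCivita p v = expMap g.leviCivita p w) (hw : IsMinimizingUpTo g hg p w 1)
    {s : ℝ} (hs : 1 < s) (hv : IsMinimizingUpTo g hg p v s) : False := by
  haveI : Fact (1 ≤ n) := ⟨le_trans (by exact_mod_cast le_top) hn⟩
  haveI : LocallyCompactSpace M := Manifold.locallyCompact_of_finiteDimensional I
  haveI : RegularSpace M := inferInstance
  set cov := g.leviCivita with hcov
  set γv : ℝ → M := maximalGeodesic cov p v with hγv
  set γw : ℝ → M := maximalGeodesic cov p w with hγw
  obtain ⟨-, hγvgeo, hγv0, hγvv⟩ := maximalGeodesic_of_isGeodesicallyComplete hc p v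
  obtain ⟨-, hγwgeo, hγw0, hγwv⟩ := maximalGeodesic_of_isGeodesicallyComplete hc p w
  have hγvv' : velocity I γv 0 = v := hγvv
  have hγw0' : γw 0 = p := hγw0
  have hγwv' : velocity I γw 0 = w := hγwv
  have hqv : expMap cov p v = γv 1 := expMap_eq_maximalGeodesic hc p v
  have hqw : expMap cov p w = γw 1 := expMap_eq_maximalGeodesic hc p w
  have h11 : γv 1 = γw 1 := by rw [← hqv, ← hqw]; exact hq
  /- finite real distances -/
  set D : M → M → ℝ := fun a b ↦ (g.edist hg a b).toReal with hDdef
  have D_nonneg : ∀ a b, 0 ≤ D a b := fun a b ↦ ENNReal.toReal_nonneg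
  have D_le : ∀ {a b : M} {r : ℝ}, g.edist hg a b ≤ ENNReal.ofReal r → 0 ≤ r → D a b ≤ r :=
    fun {a b r} h hr ↦ by
      have h' := ENNReal.toReal_mono ENNReal.ofReal_ne_top h
      rwa [ENNReal.toReal_ofReal hr] at h'
  have D_eq : ∀ {a b : M} {r : ℝ}, g.edist hg a b = ENNReal.ofReal r → 0 ≤ r → D a b = r :=
    fun {a b r} h hr ↦ by
      show (g.edist hg a b).toReal = r
      rw [h, ENNReal.toReal_ofReal hr]
  have D_triangle : ∀ a b c, g.edist hg a c ≠ ⊤ → g.edist hg a b ≠ ⊤ → g.edist hg b c ≠ ⊤ →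
      D a c ≤ D a b + D b c := fun a b c hac hab hbc ↦ by
    have h := edist_triangle hg a b c
    have h' := ENNReal.toReal_mono (ENNReal.add_ne_top.2 ⟨hab, hbc⟩) h
    rwa [ENNReal.toReal_add hab hbc] at h'
  /- `r = |v| = |w| = d(p, q) > 0` -/
  set r : ℝ := Real.sqrt (g.val p v v) with hr
  have hr0 : 0 ≤ r := Real.sqrt_nonneg _
  have hlen : ∀ (u : TangentSpace I p) (a b : ℝ), g.length hg (maximalGeodesic cov p u) a b =
      ENNReal.ofReal ((b - a) * Real.sqrt (g.val p u u)) := fun u a b ↦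
    length_maximalGeodesic hg hc p u a b
  have hv1 : IsMinimizingUpTo g hg p v 1 := hv.mono hc zero_le_one hs.le
  have hdq : g.edist hg p (γv 1) = ENNReal.ofReal r := by
    rw [← hv1.2, hlen v 0 1, sub_zero, one_mul]
  have hrw : Real.sqrt (g.val p w w) = r := by
    have h := hw.2
    rw [hlen w 0 1, sub_zero, one_mul] at h
    have h' : ENNReal.ofReal (Real.sqrt (g.val p w w)) = ENNReal.ofReal r := by
      rw [h]
      show g.edist hg p (γw 1) = ENNReal.ofReal r
      rw [← h11]
      exact hdq
    exact (ENNReal.ofReal_eq_ofReal_iff (Real.sqrt_nonneg _) hr0).1 h'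
  have hrpos : 0 < r := by
    rcases hr0.eq_or_lt with h0 | h0
    · exfalso
      apply hvw
      have hv0 : v = 0 := by
        by_contra hne
        have : 0 < g.val p v v := hg p v hne
        have : 0 < r := Real.sqrt_pos.2 this
        linarith
      have hw0 : w = 0 := by
        by_contra hne
        have h1 : 0 < g.val p w w := hg p w hne
        have h2 : 0 < Real.sqrt (g.val p w w) := Real.sqrt_pos.2 h1
        rw [hrw] at h2
        linarith
      rw [hv0, hw0]
    · exact h0
  have hvs : D p (γv s) = s * r := by
    refine D_eq ?_ (by positivity)
    rw [← hv.2, hlen v 0 s, sub_zero]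
  /- velocities at `t = 1` -/
  set V : E := (show E from velocity I γv 1) with hV
  set W : E := (show E from velocity I γw 1) with hW
  have hvv0 : 0 ≤ g.val p v v := by
    by_cases h : v = 0
    · rw [h]; simp
    · exact (hg p v h).le
  have hww0 : 0 ≤ g.val p w w := by
    by_cases h : w = 0
    · rw [h]; simp
    · exact (hg p w h).le
  have hVV : g.val (γv 1) (show TangentSpace I (γv 1) from V) (show TangentSpace I (γv 1) from V)
      = r ^ 2 := by
    show g.val (γv 1) (velocity I γv 1) (velocity I γv 1) = r ^ 2
    rw [hγv, val_velocity_maximalGeodesic hc p v 1, hr, Real.sq_sqrt hvv0]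
  have hWW : g.val (γw 1) (show TangentSpace I (γw 1) from W) (show TangentSpace I (γw 1) from W)
      = r ^ 2 := by
    show g.val (γw 1) (velocity I γw 1) (velocity I γw 1) = r ^ 2
    rw [hγw, val_velocity_maximalGeodesic hc p w 1, ← hrw, Real.sq_sqrt hww0]
  -- `V ≠ W`, else `γ_v = γ_w` and `v = w`
  have hVW : V ≠ W := by
    intro hVWeq
    apply hvw
    have heq : EqOn γv γw univ :=
      IsGeodesicOn.eqOn_of_velocity_eq_holds isOpen_univ ordConnected_univ
        (hγvgeo.isGeodesicOn univ) (hγwgeo.isGeodesicOn univ) (mem_univ 1) h11 hVWeq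
    have hfun : γv = γw := funext fun t ↦ heq (mem_univ t)
    have h1 : (show E from v) = (show E from velocity I γv 0) := by rw [hγvv']
    have h2 : (show E from w) = (show E from velocity I γw 0) := by rw [hγwv']
    have h3 : (show E from velocity I γv 0) = (show E from velocity I γw 0) := by rw [hfun]
    exact h1.trans (h3.trans h2.symm)
  /- the corner at `q₀ = γ_w 1`: `a = -r⁻¹ W`, `b = r⁻¹ V` -/
  set q₀ : M := γw 1 with hq₀
  -- transport of `V` to the base point `q₀`
  have key : ∀ (y : M) (hy : γv 1 = y),
      g.val (γv 1) (show TangentSpace I (γv 1) from V) (show TangentSpace I (γv 1) from V) =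
        g.val y (show TangentSpace I y from V) (show TangentSpace I y from V) ∧
      ∀ (c t : ℝ), maximalGeodesic cov (γv 1) (show TangentSpace I (γv 1) from c • V) t =
        maximalGeodesic cov y (show TangentSpace I y from c • V) t := by
    intro y hy
    subst hy
    exact ⟨rfl, fun _ _ ↦ rfl⟩
  obtain ⟨hVV', hgeoV⟩ := key q₀ h11
  set a : TangentSpace I q₀ := (show TangentSpace I q₀ from (-r⁻¹) • W) with ha
  set b : TangentSpace I q₀ := (show TangentSpace I q₀ from r⁻¹ • V) with hb
  have haa : g.val q₀ a a = 1 := by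
    show g.val q₀ ((-r⁻¹) • (show TangentSpace I q₀ from W)) ((-r⁻¹) • (show TangentSpace I q₀ from W)) = 1
    simp only [map_smul, smul_apply, smul_eq_mul]
    rw [show g.val q₀ (show TangentSpace I q₀ from W) (show TangentSpace I q₀ from W) = r ^ 2 from hWW]
    field_simp
  have hbb : g.val q₀ b b = 1 := by
    show g.val q₀ (r⁻¹ • (show TangentSpace I q₀ from V)) (r⁻¹ • (show TangentSpace I q₀ from V)) = 1
    simp only [map_smul, smul_apply, smul_eq_mul]
    rw [show g.val q₀ (show TangentSpace I q₀ from V) (show TangentSpace I q₀ from V) = r ^ 2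
      from hVV'.symm.trans hVV]
    field_simp
  have hab : a + b ≠ 0 := by
    intro h
    apply hVW
    have h' : r⁻¹ • (V - W) = 0 := by
      have : (show E from a) + (show E from b) = 0 := h
      rw [show (show E from a) = (-r⁻¹) • W from rfl, show (show E from b) = r⁻¹ • V from rfl] at this
      rw [smul_sub]
      linear_combination (norm := module) this
    rcases smul_eq_zero.1 h' with h1 | h1
    · exact absurd h1 (inv_ne_zero hrpos.ne')
    · exact (sub_eq_zero.1 h1)
  /- a small `δ` -/
  have hev := edist_expMap_smul_lt g hn hg q₀ haa hbb hab
  have hev2 : ∀ᶠ δ : ℝ in 𝓝[>] 0, 0 < δ ∧ δ < r ∧ δ < (s - 1) * r := by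
    have h1 : ∀ᶠ δ : ℝ in 𝓝[>] 0, 0 < δ := self_mem_nhdsWithin
    have h2 : ∀ᶠ δ : ℝ in 𝓝[>] 0, δ < r := mem_nhdsWithin_of_mem_nhds (Iio_mem_nhds hrpos)
    have h3 : ∀ᶠ δ : ℝ in 𝓝[>] 0, δ < (s - 1) * r :=
      mem_nhdsWithin_of_mem_nhds (Iio_mem_nhds (by nlinarith))
    exact h1.and (h2.and h3)
  obtain ⟨δ, hcut, hδ0, hδr, hδs⟩ := (hev.and hev2).exists
  /- the two points `exp_{q₀}(δ a) = γ_w(1 - δ/r)`, `exp_{q₀}(δ b) = γ_v(1 + δ/r)` -/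
  have hpa : expMap cov q₀ (δ • a) = γw (1 - δ / r) := by
    rw [expMap_smul hc q₀ a δ]
    show maximalGeodesic cov (γw 1) ((-r⁻¹) • velocity I γw 1) δ = γw (1 - δ / r)
    rw [maximalGeodesic_smul hc (γw 1) (velocity I γw 1) (-r⁻¹) δ, hγw,
      maximalGeodesic_velocity_apply hc p w 1]
    congr 1
    field_simp
    ring
  have hpb : expMap cov q₀ (δ • b) = γv (1 + δ / r) := by
    rw [expMap_smul hc q₀ b δ]
    show maximalGeodesic cov q₀ (show TangentSpace I q₀ from r⁻¹ • V) δ = γv (1 + δ / r)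
    rw [← hgeoV r⁻¹ δ]
    show maximalGeodesic cov (γv 1) (r⁻¹ • velocity I γv 1) δ = γv (1 + δ / r)
    rw [maximalGeodesic_smul hc (γv 1) (velocity I γv 1) r⁻¹ δ, hγv,
      maximalGeodesic_velocity_apply hc p v 1]
    congr 1
    field_simp
    ring
  rw [hpa, hpb] at hcut
  /- the distance estimates -/
  have hfinw : ∀ a' b' : ℝ, a' ≤ b' → g.edist hg (γw a') (γw b') ≤ ENNReal.ofReal ((b' - a') * r) :=
    fun a' b' hab' ↦ by
      have h := edist_maximalGeodesic_le_length hg hc p w hab'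
      rwa [hlen w a' b', hrw] at h
  have hfinv : ∀ a' b' : ℝ, a' ≤ b' → g.edist hg (γv a') (γv b') ≤ ENNReal.ofReal ((b' - a') * r) :=
    fun a' b' hab' ↦ by
      have h := edist_maximalGeodesic_le_length hg hc p v hab'
      rwa [hlen v a' b'] at h
  have hδr' : 0 ≤ 1 - δ / r := by
    rw [sub_nonneg, div_le_one hrpos]
    exact hδr.le
  have hδs' : 1 + δ / r ≤ s := by
    rw [← sub_nonneg]
    have : s - (1 + δ / r) = ((s - 1) * r - δ) / r := by field_simp; ring
    rw [this]
    exact div_nonneg (by linarith) hrpos.le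
  -- `d(p, γ_w(1 - δ/r)) ≤ r - δ`
  have e1 : g.edist hg p (γw (1 - δ / r)) ≤ ENNReal.ofReal ((1 - δ / r - 0) * r) := by
    have h := hfinw 0 (1 - δ / r) hδr'
    rwa [hγw0'] at h
  have h1 : D p (γw (1 - δ / r)) ≤ r - δ := by
    have h := D_le e1 (by nlinarith)
    have : (1 - δ / r - 0) * r = r - δ := by field_simp; ring
    linarith
  -- `d(γ_v(1 + δ/r), γ_v(s)) ≤ s r - r - δ`
  have e2 : g.edist hg (γv (1 + δ / r)) (γv s) ≤ ENNReal.ofReal ((s - (1 + δ / r)) * r) :=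
    hfinv _ _ hδs'
  have h2 : D (γv (1 + δ / r)) (γv s) ≤ s * r - r - δ := by
    have h := D_le e2 (by nlinarith [sub_nonneg.2 hδs'])
    have : (s - (1 + δ / r)) * r = s * r - r - δ := by field_simp; ring
    linarith
  -- corner: `d(γ_w(1 - δ/r), γ_v(1 + δ/r)) < 2 δ`
  have h3 : D (γw (1 - δ / r)) (γv (1 + δ / r)) < 2 * δ := by
    have hne : g.edist hg (γw (1 - δ / r)) (γv (1 + δ / r)) ≠ ⊤ := ne_top_of_lt hcut
    have h := ENNReal.toReal_strict_mono ENNReal.ofReal_ne_top hcut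
    rwa [ENNReal.toReal_ofReal (by linarith)] at h
  -- triangle inequality
  have hne1 : g.edist hg p (γw (1 - δ / r)) ≠ ⊤ := ne_top_of_le_ne_top ENNReal.ofReal_ne_top e1
  have hne2 : g.edist hg (γv (1 + δ / r)) (γv s) ≠ ⊤ := ne_top_of_le_ne_top ENNReal.ofReal_ne_top e2
  have hne3 : g.edist hg (γw (1 - δ / r)) (γv (1 + δ / r)) ≠ ⊤ := ne_top_of_lt hcut
  have hne4 : g.edist hg p (γv (1 + δ / r)) ≠ ⊤ :=
    ne_top_of_le_ne_top (ENNReal.add_ne_top.2 ⟨hne1, hne3⟩) (edist_triangle hg _ _ _)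
  have hne5 : g.edist hg p (γv s) ≠ ⊤ := by
    rw [← hv.2, hlen v 0 s]
    exact ENNReal.ofReal_ne_top
  have t1 := D_triangle p (γw (1 - δ / r)) (γv (1 + δ / r)) hne4 hne1 hne3
  have t2 := D_triangle p (γv (1 + δ / r)) (γv s) hne5 hne4 hne2
  linarith

/-! ### Lee 2018, Thm. 10.34 (b), (c) (without the differential) -/

/-- **`exp_p` is injective on the injectivity domain** (Lee 2018, Thm. 10.34 (c): "The
definition of `ID(p)` guarantees that no point in `exp_p(ID(p))` can be a cut point of `p` …
The absence of cut points implies that `exp_p` is injective on `ID(p)`").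
[cite: LeeRiemannianManifolds2018, Thm. 10.34 (c)] -/
theorem injOn_riemannianExpMap_injectivityDomain (hn : (∞ : ℕ∞ω) ≤ n) (hg : g.IsRiemannian)
    (hc : IsGeodesicallyComplete g.leviCivita) (p : M) :
    InjOn (riemannianExpMap g p) (injectivityDomain g hg p) := by
  haveI : Fact (1 ≤ n) := ⟨le_trans (by exact_mod_cast le_top) hn⟩
  intro v hv w hw hq
  by_contra hvw
  obtain ⟨s, hs, hvs⟩ := hv
  obtain ⟨s', hs', hws'⟩ := hw
  exact false_of_two_minimizers g hn hg hc p hvw hq (hws'.mono hc zero_le_one hs'.le) hs hvs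

/-- **`exp_p(ID(p)) ⊆ M ∖ Cut(p)`** (Lee 2018, Thm. 10.34 (c): "no point in `exp_p(ID(p))` can
be a cut point of `p`"): if `exp_p v = exp_p w` with `v ∈ ID(p)`, `w ∈ TCL(p)`, then `v = w` is
impossible (`ID ∩ TCL = ∅`) and `v ≠ w` contradicts `false_of_two_minimizers`.
[cite: LeeRiemannianManifolds2018, Thm. 10.34 (c)] -/
theorem image_injectivityDomain_subset_compl_geodesicCutLocus (hn : (∞ : ℕ∞ω) ≤ n)
    (hg : g.IsRiemannian) (hc : IsGeodesicallyComplete g.leviCivita) (p : M) :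
    riemannianExpMap g p '' injectivityDomain g hg p ⊆ (geodesicCutLocus g hg p)ᶜ := by
  rintro _ ⟨v, hv, rfl⟩ ⟨w, hw, hwq⟩
  obtain ⟨s, hs, hvs⟩ := hv
  by_cases hvw : v = w
  · subst hvw
    exact hw.2.2 s hs hvs
  · exact false_of_two_minimizers g hn hg hc p hvw hwq.symm hw.2.1 hs hvs

variable [ConnectedSpace M]

/-- **`exp_p(ID(p)) = M ∖ Cut(p)`** (Lee 2018, Thm. 10.34 (c)), on a connected complete manifold
(the inclusion `⊇` by Hopf–Rinow, `compl_geodesicCutLocus_subset_image_injectivityDomain` with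
`exists_isMinimizingUpTo_of_isGeodesicallyComplete`). [cite: LeeRiemannianManifolds2018, Thm. 10.34 (c)] -/
theorem image_injectivityDomain_eq_compl_geodesicCutLocus (hn : (∞ : ℕ∞ω) ≤ n)
    (hg : g.IsRiemannian) (hc : IsGeodesicallyComplete g.leviCivita) (p : M) :
    riemannianExpMap g p '' injectivityDomain g hg p = (geodesicCutLocus g hg p)ᶜ :=
  (image_injectivityDomain_subset_compl_geodesicCutLocus g hn hg hc p).antisymm
    (compl_geodesicCutLocus_subset_image_injectivityDomain hg p
      (exists_isMinimizingUpTo_of_isGeodesicallyComplete g hn hg hc p))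

/-- **`exp_p(closure ID(p)) = M`** (Lee 2018, Thm. 10.34 (b)), on a connected complete manifold
(`image_closure_injectivityDomain_eq_univ` with Hopf–Rinow). [cite: LeeRiemannianManifolds2018, Thm. 10.34 (b)] -/
theorem image_closure_injectivityDomain_eq_univ_of_isGeodesicallyComplete (hn : (∞ : ℕ∞ω) ≤ n)
    (hg : g.IsRiemannian) (hc : IsGeodesicallyComplete g.leviCivita) (p : M) :
    riemannianExpMap g p '' closure (injectivityDomain g hg p) = univ := by
  haveI : Fact (1 ≤ n) := ⟨le_trans (by exact_mod_cast le_top) hn⟩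
  exact image_closure_injectivityDomain_eq_univ hg hc p
    (exists_isMinimizingUpTo_of_isGeodesicallyComplete g hn hg hc p)

/-- **Lee 2018, Thm. 10.34 (b) and (c), all clauses but the invertibility of the differential**:
for a smooth Riemannian metric with geodesically complete Levi-Civita connection on a connected
Hausdorff manifold without boundary, `exp_p(closure ID(p)) = M`, `exp_p` is injective on `ID(p)`,
`exp_p(ID(p)) = M ∖ Cut(p)`, and `exp_p` is `C^∞` on `ID(p)`. (The remaining clause of the named
fact `lee_expMap_injectivityDomain`, bijectivity of `d(exp_p)_v` for `v ∈ ID(p)`, is Lee's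
Prop. 10.20 with Thm. 10.26 — conjugate points and Jacobi fields.)
[cite: LeeRiemannianManifolds2018, Thm. 10.34 (b),(c)] -/
theorem lee_expMap_injectivityDomain_parts (hn : (∞ : ℕ∞ω) ≤ n) (hg : g.IsRiemannian)
    (hc : IsGeodesicallyComplete g.leviCivita) (p : M) :
    riemannianExpMap g p '' closure (injectivityDomain g hg p) = univ ∧
    InjOn (riemannianExpMap g p) (injectivityDomain g hg p) ∧
    riemannianExpMap g p '' injectivityDomain g hg p = (geodesicCutLocus g hg p)ᶜ ∧
    ContMDiffOn 𝓘(ℝ, E) I ∞ (fun w : E ↦ riemannianExpMap g p (show TangentSpace I p from w))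
      {w : E | (show TangentSpace I p from w) ∈ injectivityDomain g hg p} :=
  ⟨image_closure_injectivityDomain_eq_univ_of_isGeodesicallyComplete g hn hg hc p,
    injOn_riemannianExpMap_injectivityDomain g hn hg hc p,
    image_injectivityDomain_eq_compl_geodesicCutLocus g hn hg hc p,
    contMDiffOn_riemannianExpMap_injectivityDomain g hn hg hc p⟩

end Literature.Geometry.Riemannian
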